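import Summits.BirchSwinnertonDyer.BirchSwinnertonDyer.Theorems.ByReductionTypeAtTwoSupersingularOrderTwoChar
import Summits.BirchSwinnertonDyer.BirchSwinnertonDyer.Theorems.ByReductionTypeAtTwoSupersingularOrderTwoNakayama
import Literature.NumberTheory.EllipticCurves.Kobayashi2003.SignedSelmerModuleFiniteProofs
import HarnessLib

/-!
# Route `ByReductionTypeAtTwo` (rung K4), crux `SupersingularRankZeroAtTwo` (item
# stmt-BirchSwinnertonDyer-19097), line `signed_halves_two` v3: the hardest stub at the ORDER-2
# CHARACTER, MODULE-LEVEL form — `stub_zeroKobayashiLower` ⇒ `X⁺/(γ+1)X⁺` is INFINITE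
# (seat `bsd-2adic-ss-1`, GEN 6)

HONEST FRAMING (cell `bsd-2adic`, run/shared/lean/pub/bsd-2adic/, HUMAN RULINGS D-0036/D-0059/D-0074):
THEOREMS ONLY; every research input an explicit hypothesis (the registered stub `stub_zeroKobayashiLower`
= the tree's typed `KobayashiLowerDivisibility W 2 1`, per curve; the torsion clause of Kobayashi Thm. 1.2
at `2` as the hypothesis `Module.IsTorsion` on the dual datum — its finite-generation clause is the tree
theorem `SignedSelmerDualData.moduleFinite`); no definition, no named fact, no `sorry`; nothing booked;
BSD is not proved by any of this. PARTITION (D-0054): X5@2 good-ss (B1·O1), the `a₂ = 0` sub-row (208 r0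
book230 classes: 75 with `N ≡ ±1`, 133 with `N ≡ ±3 (mod 8)`) × p = 2 — types-the-object-of; closes
none. bears_on: K4 (route-BirchSwinnertonDyer-ByReductionTypeAtTwo item 19097).

## What is proved

GEN 5 (`ByReductionTypeAtTwoSupersingularOrderTwoChar`, p451734) transported the FORCED zero
`L♭(−2) = 0` of the even-sign `2`-adic `L`-function at the order-2 character `T = −2` (layer
`ℚ₁ = ℚ(√2)`, `χ₈`; `w_E·χ₈(N_E) = +1`) through the hardest stub: every characteristic power series
`ξ⁺` of `X⁺(E/ℚ_∞)` then satisfies `ξ⁺(−2) = 0`. With the `Λ`-algebra of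
`ByReductionTypeAtTwoSupersingularOrderTwoNakayama` (factor theorem on the open disc; height-one
Nakayama; `T + 2` prime, `∤ 2`) this file upgrades that to a statement about the MODULE `X⁺`:

* §1 `not_finite_orderTwoCoinvariants_of_kobayashiLowerDivisibility_two(_of_rankZero)` — **per
  curve**: `E = W` good at `2`, `a₂ = 0`, `w_E·χ₈(N_E) = +1` (in analytic rank `0`: `χ₈(N_E) = +1`),
  `KobayashiLowerDivisibility W 2 1`, and a Pontryagin-dual datum `D` of `Sel⁺(E/ℚ_∞)` with `X⁺ = D.X`
  `Λ`-torsion ⇒ **`X⁺ ⧸ (T+2)X⁺ = X⁺/(γ+1)X⁺` is INFINITE**, i.e. `Sel⁺(E/ℚ_∞)` has positive `ℤ₂`-corank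
  at the order-2 character.
* §2 `zeroKobayashiLower_orderTwoCoinvariants_infinite` — CLASS LEVEL, hypothesis = the registered
  signature of `stub_zeroKobayashiLower` VERBATIM; and the typed obstruction in Negative-lemma shape
  `not_zeroKobayashiLower_of_finite_orderTwoCoinvariants`: ONE rank-`0`, `a₂ = 0`, `χ₈(N) = +1` curve
  with ONE torsion dual datum whose `(γ+1)`-coinvariants are FINITE refutes the stub (and with it the
  even main conjecture at `2` in the Sprung normalisation on that class).

## Why the obstruction is not expected to be constructible (memo grade, GEN 6; NOT in the kernel)

The seat's note `evidence-19097-gen6-LAG.md` (item evidence) proves, from Perrin-Riou's explicit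
reciprocity law (Colmez 1998; Berger 2003, `p = 2` in scope) and the alternating Weil form on
`D_cris`, that the `χ₈`-specialisation of the even signed local condition is the second isotropic
line of the hyperbolic plane `H¹(ℚ₂, V₂(E^{(2)}))`; consequently for every rank-`0`, `a₂ = 0`,
`χ₈(N) = +1` curve with `L(E^{(2)}, 1) ≠ 0` the `ℤ₂`-corank of `X⁺/(γ+1)X⁺` is EXACTLY `1`,
independently of the stub — §1's conclusion holds on the algebraic side anyway and §2's witness cannot
be produced; the accompanying ORDER-2 TABLE (254 members, 0 failures) tests the analytic side.

References: S. Kobayashi, Invent. Math. 152 (2003) Def. 1.1, Thm. 1.2, Conjecture p. 2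
[Kobayashi2003]; R. Greenberg, LNM 1716 (1999) p. 181 and Lemma 4.2 [GreenbergLNM1716];
F. Sprung, ANT 11 (2017) Thm. 1.12 [Sprung2017]; J. H. Silverman, AEC (2009) C.16 [SilvermanAEC2009].
-/

set_option autoImplicit false
-- the Theorems namespace of this sub repeats the summit name by design (D-0017 nested layout)
set_option linter.dupNamespace false

noncomputable section

open scoped Classical MatrixGroups ModularForm

open CongruenceSubgroup WeierstrassCurve Literature.NumberTheory.EllipticCurves
  Literature.NumberTheory.EllipticCurves.ModularForms Literature.NumberTheory.EllipticCurves.Sprung2017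
  Literature.NumberTheory.EllipticCurves.Rank1Residual Literature.NumberTheory.EllipticCurves.Rank1Residual.Typed
  Literature.NumberTheory.EllipticCurves.Kobayashi2003 ZpExtension
  Summit.BirchSwinnertonDyer.Rank1Residual Summit.BirchSwinnertonDyer.Rank1Residual.Supersingular
  Summit.BirchSwinnertonDyer.Rank1Residual.Supersingular.BlindLever

namespace Summit.BirchSwinnertonDyer.BirchSwinnertonDyer.Theorems

/-! ## §1 Per curve: the hardest stub forces INFINITE `(γ+1)`-coinvariants of `X⁺(E/ℚ_∞)` -/

section PerCurve

variable (W : WeierstrassCurve ℚ) [W.IsElliptic] [W.IsGloballyMinimal]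

/-- **MODULE-LEVEL PREDICTION OF THE HARDEST STUB AT THE ORDER-2 CHARACTER.** `E = W` with good
reduction at `2`, `a₂ = 0`, `w_E·χ₈(N_E) = +1`; assume the Eisenstein half `KobayashiLowerDivisibility W 2 1`
(the registered `stub_zeroKobayashiLower` at this curve). Then for every cyclotomic datum `(κ, γ)`, the
newform `f`, every period ratio `ϖ`, every Pollack pair at `2` and every Pontryagin-dual datum `D` of
`Sel⁺(E/ℚ_∞)` whose module `X⁺ = D.X` is `Λ`-torsion (Kobayashi Thm. 1.2 at `2`; finite generation is the
tree theorem `SignedSelmerDualData.moduleFinite`): **`X⁺ ⧸ (T+2)X⁺` is INFINITE** — `T + 2 = γ + 1`, so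
this is `X⁺/(γ+1)X⁺`, the Pontryagin dual of `Sel⁺(E/ℚ_∞)[γ+1]`: the even signed Selmer group has
POSITIVE `ℤ₂`-corank at the order-2 character. Proof: p451734 gives `ξ⁺(−2) = 0` for a generator `ξ⁺` of
`char X⁺` (principal: `charIdeal_isPrincipal_holds`); the factor theorem turns this into `(T+2) ∣ ξ⁺`;
`T + 2` is a prime element of `Λ` not dividing `2`; the height-one Nakayama lemma concludes. [cite: Kobayashi2003, Conjecture (p. 2), Def. 1.1, Thm. 1.2]
[cite: Sprung2017, Thm. 1.12 and Cor. 4.4] [cite: GreenbergLNM1716, §4 Lemma 4.2 and p. 181]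
[cite: Washington1997, §13.2] -/
theorem not_finite_orderTwoCoinvariants_of_kobayashiLowerDivisibility_two
    (hgood : W.HasGoodReductionAtPrime 2) (ha : W.frobeniusTrace 2 = 0)
    (hsign : W.rootNumber * ZMod.χ₈ (W.conductorNorm ℤ : ZMod 8) = 1)
    (hlow : KobayashiLowerDivisibility W 2 1)
    (κ : ZpExtension ℚ 2) (γ : Field.absoluteGaloisGroup ℚ)
    (hκ : κ.IsCyclotomic) (hγ : κ.IsTopGenerator γ) (hγ' : IsCyclotomicVariable 2 γ)
    [NeZero (W.conductorNorm ℤ)] (f : CuspForm (Gamma0 (W.conductorNorm ℤ)) 2) (hf : IsNewformOf W f)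
    (ϖ : ℚ) (hϖ : (ϖ : ℝ) * W.realPeriodRat = plusPeriod f)
    (Lplus Lminus : IwasawaAlgebra 2) (hPP : IsPollackPair f 2 Lplus Lminus)
    (D : SignedSelmerDualData W κ γ 1) (hXt : Module.IsTorsion (IwasawaAlgebra 2) D.X) :
    ¬ Finite (D.X ⧸ (Ideal.span {(PowerSeries.X + PowerSeries.C (2 : ℤ_[2]) : IwasawaAlgebra 2)} • ⊤ :
      Submodule (IwasawaAlgebra 2) D.X)) := by
  haveI : Module.Finite (IwasawaAlgebra 2) D.X := D.moduleFinite hγ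
  -- a generator of `char X⁺`
  haveI : (Literature.NumberTheory.EllipticCurves.Module.charIdeal (IwasawaAlgebra 2) D.X).IsPrincipal :=
    charIdeal_isPrincipal_holds 2 D.X
  obtain ⟨g, hg⟩ := Submodule.IsPrincipal.principal
    (Literature.NumberTheory.EllipticCurves.Module.charIdeal (IwasawaAlgebra 2) D.X)
  have hg' : D.charIdeal = Ideal.span {g} := hg
  -- GEN 5: `ξ⁺(−2) = 0`
  have hev := evalAt_neg_two_charGenerator_eq_zero_of_kobayashiLowerDivisibility_two W hgood ha hsign
    hlow κ γ hκ hγ hγ' f hf ϖ hϖ Lplus Lminus hPP D g hg'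
  -- factor theorem: `(T + 2) ∣ ξ⁺`
  have hdvd : (PowerSeries.X + PowerSeries.C (2 : ℤ_[2]) : IwasawaAlgebra 2) ∣ g := by
    have h := X_sub_C_dvd_of_evalAt_eq_zero norm_neg_two_lt_one hev
    rwa [map_neg, sub_neg_eq_add] at h
  -- height-one Nakayama at the prime `T + 2 ∤ 2`
  exact not_finite_quotient_of_prime_dvd_charGenerator (p := 2) hXt prime_X_add_C_two
    not_X_add_C_two_dvd_C_two hg hdvd

/-- **On the crux's domain the sign is the conductor class mod 8.** In analytic rank `0` the root number is
`+1` unconditionally (`rootNumber_eq_one_of_even_analyticRank`), so: `a₂ = 0`, `χ₈(N_E) = +1`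
(`N_E ≡ ±1 (mod 8)`), `KobayashiLowerDivisibility W 2 1`, `X⁺` torsion ⇒ `X⁺/(γ+1)X⁺` is infinite.
[cite: SilvermanAEC2009, C.16 Thm. 16.3] [cite: Kobayashi2003, Conjecture (p. 2)]
[cite: Sprung2017, Thm. 1.12 and Cor. 4.4] -/
theorem not_finite_orderTwoCoinvariants_of_kobayashiLowerDivisibility_two_of_rankZero
    (hgood : W.HasGoodReductionAtPrime 2) (ha : W.frobeniusTrace 2 = 0) (hr : W.analyticRank = 0)
    (hχ : ZMod.χ₈ (W.conductorNorm ℤ : ZMod 8) = 1)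
    (hlow : KobayashiLowerDivisibility W 2 1)
    (κ : ZpExtension ℚ 2) (γ : Field.absoluteGaloisGroup ℚ)
    (hκ : κ.IsCyclotomic) (hγ : κ.IsTopGenerator γ) (hγ' : IsCyclotomicVariable 2 γ)
    [NeZero (W.conductorNorm ℤ)] (f : CuspForm (Gamma0 (W.conductorNorm ℤ)) 2) (hf : IsNewformOf W f)
    (ϖ : ℚ) (hϖ : (ϖ : ℝ) * W.realPeriodRat = plusPeriod f)
    (Lplus Lminus : IwasawaAlgebra 2) (hPP : IsPollackPair f 2 Lplus Lminus)
    (D : SignedSelmerDualData W κ γ 1) (hXt : Module.IsTorsion (IwasawaAlgebra 2) D.X) :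
    ¬ Finite (D.X ⧸ (Ideal.span {(PowerSeries.X + PowerSeries.C (2 : ℤ_[2]) : IwasawaAlgebra 2)} • ⊤ :
      Submodule (IwasawaAlgebra 2) D.X)) := by
  have hw : W.rootNumber = 1 := W.rootNumber_eq_one_of_even_analyticRank (by rw [hr]; exact ⟨0, rfl⟩)
  exact not_finite_orderTwoCoinvariants_of_kobayashiLowerDivisibility_two W hgood ha
    (by rw [hw, one_mul, hχ]) hlow κ γ hκ hγ hγ' f hf ϖ hϖ Lplus Lminus hPP D hXt

end PerCurve

/-! ## §2 Class level, and the typed obstruction in Negative-lemma shape -/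

/-- **CLASS LEVEL: `stub_zeroKobayashiLower` (registered signature VERBATIM as the hypothesis) ⇒ on the
`a₂ = 0` sub-row of the crux's domain with `χ₈(N_E) = +1`, for every cyclotomic datum, newform, period
ratio, Pollack pair and every `Λ`-torsion dual datum, `X⁺(E/ℚ_∞)/(γ+1)X⁺(E/ℚ_∞)` is INFINITE.** The
falsifiable MODULE-LEVEL content of the hardest stub at the second `ℤ₂`-point of `Λ`.
[cite: Kobayashi2003, Conjecture (p. 2), Def. 1.1, Thm. 1.2] [cite: Sprung2017, Thm. 1.12 and Cor. 4.4]
[cite: SilvermanAEC2009, C.16 Thm. 16.3] -/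
theorem zeroKobayashiLower_orderTwoCoinvariants_infinite
    (hlow : ∀ (W : WeierstrassCurve ℚ) [W.IsElliptic] [W.IsGloballyMinimal],
      ¬ W.HasCM → W.analyticRank = 0 → GoodSS W 2 → W.frobeniusTrace 2 = 0 →
        KobayashiLowerDivisibility W 2 1) :
    ∀ (W : WeierstrassCurve ℚ) [W.IsElliptic] [W.IsGloballyMinimal],
      ¬ W.HasCM → W.analyticRank = 0 → GoodSS W 2 → W.frobeniusTrace 2 = 0 →
      ZMod.χ₈ (W.conductorNorm ℤ : ZMod 8) = 1 →
      ∀ (κ : ZpExtension ℚ 2) (γ : Field.absoluteGaloisGroup ℚ),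
        κ.IsCyclotomic → κ.IsTopGenerator γ → IsCyclotomicVariable 2 γ →
      ∀ [NeZero (W.conductorNorm ℤ)] (f : CuspForm (Gamma0 (W.conductorNorm ℤ)) 2),
        IsNewformOf W f → ∀ (ϖ : ℚ), (ϖ : ℝ) * W.realPeriodRat = plusPeriod f →
      ∀ (Lplus Lminus : IwasawaAlgebra 2), IsPollackPair f 2 Lplus Lminus →
      ∀ (D : SignedSelmerDualData W κ γ 1), Module.IsTorsion (IwasawaAlgebra 2) D.X →
        ¬ Finite (D.X ⧸ (Ideal.span {(PowerSeries.X + PowerSeries.C (2 : ℤ_[2]) : IwasawaAlgebra 2)} • ⊤ :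
          Submodule (IwasawaAlgebra 2) D.X)) :=
  fun W _ _ hcm hr hss ha hχ κ γ hκ hγ hγ' _ f hf ϖ hϖ Lp Lm hPP D hXt ↦
    not_finite_orderTwoCoinvariants_of_kobayashiLowerDivisibility_two_of_rankZero W hss.1 ha hr hχ
      (hlow W hcm hr hss ha) κ γ hκ hγ hγ' f hf ϖ hϖ Lp Lm hPP D hXt

/-- **THE TYPED OBSTRUCTION (Negative-lemma shape).** ONE non-CM `E = W` of analytic rank `0` with good
supersingular reduction at `2`, `a₂ = 0`, `χ₈(N_E) = +1`, together with a cyclotomic datum, the newform,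
a period ratio, a Pollack pair at `2` and ONE `Λ`-torsion dual datum `D` of `Sel⁺(E/ℚ_∞)` whose
`(γ+1)`-coinvariants `X⁺/(T+2)X⁺` are FINITE, REFUTES the registered `stub_zeroKobayashiLower` (and with
it the even signed main conjecture at `2` in the Sprung normalisation on that class). GEN 6's memo
(item evidence `evidence-19097-gen6-LAG.md`) shows from Perrin-Riou's explicit reciprocity law that
this witness is not expected to exist: for such curves with `L(E^{(2)},1) ≠ 0` the `ℤ₂`-corank of
`X⁺/(γ+1)X⁺` is `1` independently of the stub. [cite: Kobayashi2003, Conjecture (p. 2), Def. 1.1, Thm. 1.2]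
[cite: Sprung2017, Thm. 1.12 and Cor. 4.4] [cite: GreenbergLNM1716, p. 181] -/
theorem not_zeroKobayashiLower_of_finite_orderTwoCoinvariants
    (W : WeierstrassCurve ℚ) [W.IsElliptic] [W.IsGloballyMinimal]
    (hcm : ¬ W.HasCM) (hr : W.analyticRank = 0) (hss : GoodSS W 2) (ha : W.frobeniusTrace 2 = 0)
    (hχ : ZMod.χ₈ (W.conductorNorm ℤ : ZMod 8) = 1)
    (κ : ZpExtension ℚ 2) (γ : Field.absoluteGaloisGroup ℚ)
    (hκ : κ.IsCyclotomic) (hγ : κ.IsTopGenerator γ) (hγ' : IsCyclotomicVariable 2 γ)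
    [NeZero (W.conductorNorm ℤ)] (f : CuspForm (Gamma0 (W.conductorNorm ℤ)) 2) (hf : IsNewformOf W f)
    (ϖ : ℚ) (hϖ : (ϖ : ℝ) * W.realPeriodRat = plusPeriod f)
    (Lplus Lminus : IwasawaAlgebra 2) (hPP : IsPollackPair f 2 Lplus Lminus)
    (D : SignedSelmerDualData W κ γ 1) (hXt : Module.IsTorsion (IwasawaAlgebra 2) D.X)
    (hfin : Finite (D.X ⧸ (Ideal.span {(PowerSeries.X + PowerSeries.C (2 : ℤ_[2]) : IwasawaAlgebra 2)} • ⊤ :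
      Submodule (IwasawaAlgebra 2) D.X))) :
    ¬ (∀ (W : WeierstrassCurve ℚ) [W.IsElliptic] [W.IsGloballyMinimal],
        ¬ W.HasCM → W.analyticRank = 0 → GoodSS W 2 → W.frobeniusTrace 2 = 0 →
          KobayashiLowerDivisibility W 2 1) :=
  fun hlow ↦ zeroKobayashiLower_orderTwoCoinvariants_infinite hlow W hcm hr hss ha hχ κ γ hκ hγ hγ' f hf
    ϖ hϖ Lplus Lminus hPP D hXt hfin

end Summit.BirchSwinnertonDyer.BirchSwinnertonDyer.Theorems

end
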